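import Summits.QuantumFields.BalabanUV.T4Continuum.Support.NE3CovariantLineSumsError
import HarnessLib

/-!
# T⁴ programme, node NE3, row E-MLw-(w4)-P · Φ5 (tangency half) — ON THE CURVED FRAME-FREE SLICE THE DOUBLE-BAR k-FOLD AVERAGE VANISHES
# IDENTICALLY AND THE STRAIGHT COVARIANT AVERAGE IS THE ACCUMULATED ERROR ALONE: «S_W = E», k-uniformly small

NE3 formalisation swarm `b2b-balaban-t4-ne3-formalise-*`, LEAF PROVER 04 (gen 4), row **Φ5** (its «Set + tangency» part assigned to leaf-04) of
the owner's re-cut (`t4-ne3-p1-g21`, RULING ρ-g21-3 ∕ `HOME/t4/b2b-balaban-t4-ne3-p1/g21/D-ne3p1-g21-2.md` (V6): on the frame-free slice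
`T_♮(W) ⊂ ker d(avgIter k)(W) ∩ {framePot_W = 0}` «the tangency reading is S_W = E (w4-S error only)»; INTENT HOME/CLAIMS.log ≈15:29Z).
The TANGENCY half, hypotheses explicit (the T_♮(W) Set waits for Φ1's flat clause shapes): corollaries BY NAME of this unit's
`NE3TangentCovariantTower` (structure theorem), `NE3CovariantLineSumsTower` (exact error recursion) and `NE3CovariantLineSumsError` (k-uniform estimate).

CONTENT (all [folklore]; 0 sorry; 0 def):
* **`QbarIter_eq_zero_of_frameFree`** — in the multi-level small-field class, `TangentIter L j W Y ∧ framePotW L (j+1) W Y = 0 ⇒ QbarIter L (j+1) W Y = 0`: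
  the double-bar k-fold average (B7's V̄-framed reading (120)) of a frame-free tangent direction vanishes IDENTICALLY — no error at all;
* **`QstrIter_eq_neg_ErrIter_of_frameFree`** — hence `QstrIter L (j+1) W Y = −ErrIter L (j+1) W Y` («S_W = E»);
* **`norm_QstrIter_le_of_frameFree`** — for `L ≥ 2` and `‖Y‖_∞ ≤ s`: `‖QstrIter L (j+1) W Y z κ‖ ≤ (8∕3)·wC d L ((prop1Radius d L)^[j] x)·L^j·s`
  (k-FREE; vs the generic size `L^{j+1}·s` of a k-fold straight average this is the relative smallness `(8∕3)·wC(top)∕L = O((d+1)(d+4)·L·Csup·(top radius))`).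

HONEST: covariant kinematics on OUR frame; (P_W)∕(ML_w) at W = cavg L U_B, Φ3 = (μK)♮, T-E_w, NE3 NOT proved; spine 0∕9; finite T⁴ rung (B)+1 — NOT
infinite volume, NOT mass gap, NOT BetaPertH, NOT Clay.  PLACEMENT: `Summits/QuantumFields/BalabanUV/`.
-/

set_option autoImplicit false

open scoped BigOperators Matrix.Norms.L2Operator
open Finset

namespace Summit.QuantumFields.BalabanUV.T4Continuum.NE3FrameFreeTangency

open Literature.MathematicalPhysics.QuantumFieldTheory.Balaban1983to89
open B7Prop1Explicit B7Prop2Explicit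
open T4AveragingDeficitWall (IsUnitaryCfg IsSkewDir SmallField Ad)
open T4AveragingDeficitWallBoundary (IsPeriodicCfg)
open AveragingDeficitPeriodicCounting (IsPeriodicDir)
open AveragingDeficitMultiLevelPrep (cavgIter TangentIter tower LevelSmall)
open AveragingDeficitTwoLevelPrep (prop1Radius)
open BlockAveragePushDirGauge (gaugeDir)
open NE3TangentCovariantTower (QbarIter framePotW QbarIter_eq_neg_gaugeDir_of_tangentIter)
open NE3CovariantLineSumsTower (QstrIter ErrIter QbarIter_eq_QstrIter_add_ErrIter)
open NE3CovariantLineSumsError (wC norm_ErrIter_le_of_levelSmall)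

noncomputable section

variable {d : ℕ} {n : Type*} [Fintype n] [DecidableEq n] [Nonempty n]

/-- **ON THE FRAME-FREE SLICE THE DOUBLE-BAR k-FOLD AVERAGE VANISHES IDENTICALLY**: in the multi-level small-field class,
`TangentIter L j W Y`, `framePotW L (j+1) W Y = 0` ⇒ `QbarIter L (j+1) W Y = 0`. [cite: Balaban1985Averaging, (120) p.35] -/
theorem QbarIter_eq_zero_of_frameFree {L M : ℕ} [NeZero M] (hL : 1 ≤ L) (j : ℕ) {W : Site d → Fin d → (Matrix n n ℂ)ˣ} {x : ℝ}
    (hWu : IsUnitaryCfg W) (hWP : IsPeriodicCfg W ((tower L M (j + 1) : ℕ) : ℤ)) (hx : 0 ≤ x) (hs : LevelSmall d L j x)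
    (hWx : SmallField W x) {Y : Site d → Fin d → Matrix n n ℂ} (hY : IsSkewDir Y) (hYP : IsPeriodicDir Y ((tower L M (j + 1) : ℕ) : ℤ))
    (hT : TangentIter L j W Y) (hF : framePotW L (j + 1) W Y = 0) :
    QbarIter L (j + 1) W Y = 0 := by
  rw [QbarIter_eq_neg_gaugeDir_of_tangentIter (M := M) hL j hWu hWP hx hs hWx hY hYP hT, hF]
  funext z κ
  simp [gaugeDir, Ad]

/-- **«S_W = E»**: on the frame-free slice the straight covariant k-fold block-line average IS minus the accumulated error. [folklore] -/
theorem QstrIter_eq_neg_ErrIter_of_frameFree {L M : ℕ} [NeZero M] (hL : 1 ≤ L) (j : ℕ) {W : Site d → Fin d → (Matrix n n ℂ)ˣ} {x : ℝ}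
    (hWu : IsUnitaryCfg W) (hWP : IsPeriodicCfg W ((tower L M (j + 1) : ℕ) : ℤ)) (hx : 0 ≤ x) (hs : LevelSmall d L j x)
    (hWx : SmallField W x) {Y : Site d → Fin d → Matrix n n ℂ} (hY : IsSkewDir Y) (hYP : IsPeriodicDir Y ((tower L M (j + 1) : ℕ) : ℤ))
    (hT : TangentIter L j W Y) (hF : framePotW L (j + 1) W Y = 0) :
    QstrIter L (j + 1) W Y = fun z κ => -ErrIter L (j + 1) W Y z κ := by
  have h0 := QbarIter_eq_zero_of_frameFree (M := M) hL j hWu hWP hx hs hWx hY hYP hT hF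
  have h1 := QbarIter_eq_QstrIter_add_ErrIter hL j hWu hx hs hWx Y
  rw [h0] at h1
  funext z κ
  have hz : QstrIter L (j + 1) W Y z κ + ErrIter L (j + 1) W Y z κ = 0 := by
    have := congr_fun (congr_fun h1 z) κ
    simpa using this.symm
  exact eq_neg_of_add_eq_zero_left hz

/-- **THE STRAIGHT COVARIANT AVERAGE OF A FRAME-FREE TANGENT DIRECTION IS k-UNIFORMLY SMALL** (`L ≥ 2`, sup currency):
`‖QstrIter L (j+1) W Y z κ‖ ≤ (8∕3)·wC d L ((prop1Radius d L)^[j] x)·L^j·s` for `‖Y‖_∞ ≤ s`. [folklore] -/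
theorem norm_QstrIter_le_of_frameFree {L M : ℕ} [NeZero M] (hL : 2 ≤ L) (j : ℕ) {W : Site d → Fin d → (Matrix n n ℂ)ˣ} {x : ℝ}
    (hWu : IsUnitaryCfg W) (hWP : IsPeriodicCfg W ((tower L M (j + 1) : ℕ) : ℤ)) (hx : 0 ≤ x) (hs : LevelSmall d L j x)
    (hWx : SmallField W x) {Y : Site d → Fin d → Matrix n n ℂ} (hY : IsSkewDir Y) (hYP : IsPeriodicDir Y ((tower L M (j + 1) : ℕ) : ℤ))
    (hT : TangentIter L j W Y) (hF : framePotW L (j + 1) W Y = 0) {s : ℝ} (hs0 : 0 ≤ s)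
    (hYs : ∀ (y : Site d) (μ : Fin d), ‖Y y μ‖ ≤ s) (z : Site d) (κ : Fin d) :
    ‖QstrIter L (j + 1) W Y z κ‖ ≤ 8 / 3 * wC d L ((prop1Radius d L)^[j] x) * (L : ℝ) ^ j * s := by
  rw [QstrIter_eq_neg_ErrIter_of_frameFree (M := M) (by omega) j hWu hWP hx hs hWx hY hYP hT hF]
  simp only [norm_neg]
  exact norm_ErrIter_le_of_levelSmall hL j hWu hx hs hWx hs0 hYs z κ

end

end Summit.QuantumFields.BalabanUV.T4Continuum.NE3FrameFreeTangency
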